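/-
Copyright (c) 2026 the pub-hodgecm-mathlib formalisation cell (harness21).  Prover seat hodgecm-mathlib-LH4-p09 (g11) ((β) payer; LH4-p14 (g9) F2 census 2026-09-05T03:33:11Z
K-TYPE finding, option (A)), Track B «K2-LIT» ∕ hLiu418 socket #41 KIND 1, package (K1b-♮), letter (dec-2): THE PER-PLACE FACTOR FOR A FINITE-DIMENSIONAL `K_w`-TYPE.  THEOREMS ONLY.
-/
import Summits.HodgeConjecture.HodgeConjecture.Theorems.K2LiuKindOneLineCornerArchFactorBounded   -- ★ (β-3) p864675 (+ ★ (β-2) p864580, ★ (β-1) p864497, ★ (e∞), ★ p862843, ★ (dec-3c))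
import HarnessLib

/-!
# Crux `HLiu418`, socket #41, KIND 1 — (dec-2)∕(β) `K2LiuKindOneLineCornerArchFactorKType`: THE PER-PLACE FACTOR FOR A FINITE-DIMENSIONAL UNITARY `K_w`-TYPE

Cell `hodgecm-mathlib`, crux item hLiu418 = `stmt-HodgeConjecture-24832` (helper lane `--supports … --as helper`, count-neutral), route of record `HCCMUnconditional`;
squad K2 ∕ K2Liu; K1b desk K2Liu-p14 (g5); LH4-p14 (g9)'s F2 census (2026-09-05T03:33:11Z) K-TYPE FINDING, option (A).  THEOREMS ONLY (no `def`, no `instance`,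
no notation, no named-fact hypothesis, no `sorry`).

THE POINT.  ★ (β-2) `norm_corner_lineWhittaker_le_of_blockDecomp` ∕ ★ (β-3) `…_of_boundedMovers` take a SCALAR `K_w`-type letter (`f(g·k) = ρ_k·f(g)`, `‖ρ_k‖ ≤ 1`).  The tie's
section family is an arbitrary STANDARD family, whose archimedean tensor factors carry arbitrary finite-dimensional `K_w`-types: a component `F i` of a tuple `F : Fin d → …`
with `F i (g·k) = Σ_j τ(k) i j · F j (g)` for `k ∈ U(J) ∩ Stab(i·1)`, `τ(k)` unitary (entries `≤ 1`).  THIS FILE is the twin of (β-2) §1 and (β-3) for that class: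
* §1 **`norm_corner_lineWhittaker_le_of_blockDecomp_kType`** — tuple of Siegel sections of `I_w(s,χ)`, the `K_w`-TYPE LETTER BY VALUE in matrix form, ONE line letter for
  every component, and — forced by the sum — integrability BY VALUE of the line integrands `t ↦ F j (ι(J₁ n₁(t) x))`; at a unitary-mover block decomposition
  `‖∫ F i(ι(J₁n₁(t))·g)e^{−2πiμt}dt‖ ≤ d·C_L·ρ^{−(2re s+1)}·‖det Y‖^{2re s+2}·((1+|μ|ρ)·e^{−π|μ|ρ})` (★ (β-1) four factors → `K_w`-type AT THE POINT → ★ (e∞) `corner_reading` per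
  component with `κ := 1` → `integral_finset_sum` → ★ (e∞) `corner_lineWhittaker_iwasawa` per component → `Σ_j ‖τ i j‖ ≤ d`);
* §2 `le_of_unitary_decompositions` — the MOVER COMPARISON of ★ (β-3) with the left side ABSTRACTED to a real `Q` (so every head of (β-2) shape transfers to the `M`-bounded class);
  **`norm_corner_lineWhittaker_le_of_boundedMovers_kType`** — the `M`-bounded twin at the payer-chosen rate `π∕(64M²)`.
[Shimura1997, §16, §18.4]; [KudlaRallis1994, §2]; [BorelJacquet1979, §1.2, §4.1]; [MoeglinWaldspurger1995, II.1.7]; [Knapp1986, Ch. VIII §2].  HONEST LABEL: count-neutral helper,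
hypothesis-first; closes no socket: `HC_CM` is proved only modulo the 7 printed citations (2 remaining: hLiu418 = `stmt-HodgeConjecture-24832`, h413 = `…-24833`) until rung 0 closes.
-/

set_option autoImplicit false
set_option linter.dupNamespace false -- the mandated namespace repeats `HodgeConjecture.HodgeConjecture`

noncomputable section

namespace Summit.HodgeConjecture.HodgeConjecture.Cruxes.HLiu418.K2LiuKindOneLineCornerArchFactorKType

open Matrix Complex MeasureTheory
open scoped ComplexConjugate Matrix BigOperators
open Literature.NumberTheory.ModularForms.SiegelUpperHalfSpace (moeb)
open Summit.HodgeConjecture.HodgeConjecture.Cruxes.HLiu418.K2LiuArchInducedTubeDefs (IsArchSiegelSection)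
open Summit.HodgeConjecture.HodgeConjecture.Cruxes.HLiu418.K2LiuKindOneLineCornerArchIwasawa (exists_fourFactor_of_blockDecomp)
open Summit.HodgeConjecture.HodgeConjecture.Cruxes.HLiu418.K2LiuKindOneLineCornerArchReading (corner_reading corner_lineWhittaker_iwasawa)
open Summit.HodgeConjecture.HodgeConjecture.Cruxes.HLiu418.K2LiuKindOneLineWhittakerIwasawa (norm_exp_phase)
open Summit.HodgeConjecture.HodgeConjecture.Cruxes.HLiu418.K2LiuKindOneLineCornerArchFactor (rpow_bookkeeping)
open Summit.HodgeConjecture.HodgeConjecture.Cruxes.HLiu418.K2LiuKindOneLineCornerArchFactorBounded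
  (norm_unitary_mul_apply_le norm_mul_unitary_conjTranspose_apply_le rowSq_mul_le rpow_le_mul_rpow_of_two_sided)
open Summit.HodgeConjecture.HodgeConjecture.Cruxes.HLiu418.K2LiuSiegelEisensteinKindWBlockAtPoint (exists_blockUpper_mul_unitary)
open Summit.HodgeConjecture.HodgeConjecture.Cruxes.HLiu418.K2LiuArchBlockHeightBound (norm_det_le_of_entry_le)

variable (ι : Matrix (Fin 1 ⊕ Fin 1) (Fin 1 ⊕ Fin 1) ℂ → Matrix (Fin 2 ⊕ Fin 2) (Fin 2 ⊕ Fin 2) ℂ)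
    (hι : ∀ x, ι x = fromBlocks !![1, 0; 0, x (Sum.inl 0) (Sum.inl 0)] !![0, 0; 0, x (Sum.inl 0) (Sum.inr 0)] !![0, 0; 0, x (Sum.inr 0) (Sum.inl 0)] !![1, 0; 0, x (Sum.inr 0) (Sum.inr 0)])

/-! ## §1 The per-place factor for a finite-dimensional `K_w`-type, unitary mover -/

include hι in
/-- **THE PER-PLACE FACTOR FOR A FINITE-DIMENSIONAL UNITARY `K_w`-TYPE (unitary mover).**  Tube frame of `U(2,2)`, corner map `ι` BY VALUE; a tuple `F : Fin d → …` of Siegel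
sections of `I_w(s,χ)` (`χ 1 = 1`, `‖χ z‖ ≤ 1` off `0`); the `K_w`-TYPE LETTER BY VALUE in matrix form (every `k ∈ U(J)` fixing `i·1` acts on the tuple by a matrix with entries of
norm `≤ 1` — e.g. a unitary one); ONE line letter for every component at rate `π`; integrability of the line integrands BY VALUE; a point `g = [Y, B; 0, D]·κ ∈ U(J)` with `κ`
unitary.  THEN for every component `i` and real `μ`:
`‖∫ F i (ι(J₁ n₁(t)) · g) e^{−2πiμt} dt‖ ≤ d · C_L · ρ^{−(2 re s+1)} · ‖det Y‖^{2 re s+2} · ((1 + |μ|ρ) · e^{−π|μ|ρ})`, `ρ = Σ_j ‖Y 1 j‖²`.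
[cite: Shimura1997, §16, §18.4] [cite: KudlaRallis1994, §2] [cite: BorelJacquet1979, §1.2, §4.1] [cite: Knapp1986, Ch. VIII §2] -/
theorem norm_corner_lineWhittaker_le_of_blockDecomp_kType {d : ℕ}
    {χ : ℂ → ℂ} {s : ℂ} {F : Fin d → Matrix (Fin 2 ⊕ Fin 2) (Fin 2 ⊕ Fin 2) ℂ → ℂ} (hf : ∀ j, IsArchSiegelSection χ s (F j)) (hχ1 : χ 1 = 1)
    (hχ : ∀ z : ℂ, z ≠ 0 → ‖χ z‖ ≤ 1)
    (hK : ∀ k : Matrix (Fin 2 ⊕ Fin 2) (Fin 2 ⊕ Fin 2) ℂ, kᴴ * Matrix.J (Fin 2) ℂ * k = Matrix.J (Fin 2) ℂ →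
      moeb k (I • (1 : Matrix (Fin 2) (Fin 2) ℂ)) = I • 1 →
      ∃ τ : Matrix (Fin d) (Fin d) ℂ, (∀ i j, ‖τ i j‖ ≤ 1) ∧ ∀ (g : Matrix (Fin 2 ⊕ Fin 2) (Fin 2 ⊕ Fin 2) ℂ) (i : Fin d), F i (g * k) = ∑ j, τ i j * F j g)
    {CL : ℝ}
    (hline : ∀ (j : Fin d) (h : ℝ), ‖∫ t : ℝ, F j (ι (Matrix.J (Fin 1) ℂ * fromBlocks 1 ((t : ℂ) • (1 : Matrix (Fin 1) (Fin 1) ℂ)) 0 1)) *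
        Complex.exp (-(2 * Real.pi * I * h * t))‖ ≤ CL * (1 + |h|) * Real.exp (-(Real.pi * |h|)))
    (hint : ∀ (j : Fin d) (x : Matrix (Fin 1 ⊕ Fin 1) (Fin 1 ⊕ Fin 1) ℂ),
      Integrable (fun t : ℝ => F j (ι (Matrix.J (Fin 1) ℂ * fromBlocks 1 ((t : ℂ) • (1 : Matrix (Fin 1) (Fin 1) ℂ)) 0 1 * x))))
    {Y B D : Matrix (Fin 2) (Fin 2) ℂ} {κ : Matrix (Fin 2 ⊕ Fin 2) (Fin 2 ⊕ Fin 2) ℂ}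
    (hg : (fromBlocks Y B 0 D * κ)ᴴ * Matrix.J (Fin 2) ℂ * (fromBlocks Y B 0 D * κ) = Matrix.J (Fin 2) ℂ) (hκ : κ * κᴴ = 1) (hκ' : κᴴ * κ = 1) (μ : ℝ) (i : Fin d) :
    ‖∫ t : ℝ, F i (ι (Matrix.J (Fin 1) ℂ * fromBlocks 1 ((t : ℂ) • (1 : Matrix (Fin 1) (Fin 1) ℂ)) 0 1) * (fromBlocks Y B 0 D * κ)) *
        Complex.exp (-(2 * Real.pi * I * μ * t))‖ ≤
      d * CL * (∑ j, ‖Y 1 j‖ ^ 2) ^ (-(2 * s.re + 1)) * ‖Y.det‖ ^ (2 * s.re + 2) *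
        ((1 + |μ| * ∑ j, ‖Y 1 j‖ ^ 2) * Real.exp (-(Real.pi * (|μ| * ∑ j, ‖Y 1 j‖ ^ 2)))) := by
  obtain ⟨r, u, c, b, b₀, n, k, hr, hn, hkJ, hkI, -, hfour, hn2, hrn⟩ := exists_fourFactor_of_blockDecomp hg hκ hκ'
  obtain ⟨τ, hτ, hFk⟩ := hK k hkJ hkI
  have hnC : (n : ℂ) ≠ 0 := ofReal_ne_zero.2 hn.ne'
  -- the line's Levi pair `a = (n)`, `d = (n⁻¹)` and the corner factor written through `ι`
  set a : Matrix (Fin 1) (Fin 1) ℂ := !![(n : ℂ)] with ha_def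
  set dm : Matrix (Fin 1) (Fin 1) ℂ := !![((n : ℂ))⁻¹] with hd_def
  have ha00 : a 0 0 = (n : ℂ) := by simp [ha_def]
  have hd00 : dm 0 0 = ((n : ℂ))⁻¹ := by simp [hd_def]
  have had : aᴴ * dm = 1 := by
    ext i' j'
    fin_cases i'; fin_cases j'
    simp [Matrix.mul_apply, conjTranspose_apply, ha_def, hd_def, hnC]
  have hι4 : ι (fromBlocks 1 ((b₀ : ℂ) • (1 : Matrix (Fin 1) (Fin 1) ℂ)) 0 1 * fromBlocks a 0 0 dm) =
      fromBlocks !![1, 0; 0, (n : ℂ)] !![0, 0; 0, (b₀ : ℂ) * (n : ℂ)⁻¹] 0 !![1, 0; 0, (n : ℂ)⁻¹] := by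
    rw [hι, fromBlocks_multiply]
    ext i' j'
    rcases i' with i' | i' <;> rcases j' with j' | j' <;> fin_cases i' <;> fin_cases j' <;> simp [ha_def, hd_def, fromBlocks]
  have hone : ∀ (j : Fin d) (g : Matrix (Fin 2 ⊕ Fin 2) (Fin 2 ⊕ Fin 2) ℂ), F j (g * 1) = 1 * F j g := fun j g => by rw [Matrix.mul_one, one_mul]
  -- the `K_w`-type AT THE POINT: `F i (w₀n₂(t)·P₀·k) = Σ_j τ i j · F j (w₀n₂(t)·P₀·1)`
  have hsplit : ∀ t : ℝ, F i (ι (Matrix.J (Fin 1) ℂ * fromBlocks 1 ((t : ℂ) • (1 : Matrix (Fin 1) (Fin 1) ℂ)) 0 1) * (fromBlocks Y B 0 D * κ)) =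
      ∑ j, τ i j * F j (ι (Matrix.J (Fin 1) ℂ * fromBlocks 1 ((t : ℂ) • (1 : Matrix (Fin 1) (Fin 1) ℂ)) 0 1) *
        (fromBlocks !![r, 0; 0, 1] 0 0 !![(conj r)⁻¹, 0; 0, 1] * fromBlocks !![1, u; 0, 1] 0 0 !![1, 0; -conj u, 1] *
          fromBlocks 1 !![(b : ℂ), c; conj c, 0] 0 1 * ι (fromBlocks 1 ((b₀ : ℂ) • (1 : Matrix (Fin 1) (Fin 1) ℂ)) 0 1 * fromBlocks a 0 0 dm) * 1)) := fun t => by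
    rw [hfour, hι4, Matrix.mul_one, ← hFk]
    congr 1
    simp only [Matrix.mul_assoc]
  -- the corner reading per component (★ (e∞), `κ := 1`)
  have hread : ∀ (j : Fin d) (t : ℝ), F j (ι (Matrix.J (Fin 1) ℂ * fromBlocks 1 ((t : ℂ) • (1 : Matrix (Fin 1) (Fin 1) ℂ)) 0 1) *
        (fromBlocks !![r, 0; 0, 1] 0 0 !![(conj r)⁻¹, 0; 0, 1] * fromBlocks !![1, u; 0, 1] 0 0 !![1, 0; -conj u, 1] *
          fromBlocks 1 !![(b : ℂ), c; conj c, 0] 0 1 * ι (fromBlocks 1 ((b₀ : ℂ) • (1 : Matrix (Fin 1) (Fin 1) ℂ)) 0 1 * fromBlocks a 0 0 dm) * 1)) =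
      1 * (χ r * ((‖r‖ : ℝ) : ℂ) ^ (2 * s + 2)) *
        F j (ι (Matrix.J (Fin 1) ℂ * fromBlocks 1 ((t : ℂ) • (1 : Matrix (Fin 1) (Fin 1) ℂ)) 0 1 *
          (fromBlocks 1 ((b₀ : ℂ) • (1 : Matrix (Fin 1) (Fin 1) ℂ)) 0 1 * fromBlocks a 0 0 dm))) := fun j t =>
    corner_reading ι hι (hf j) hχ1 hr u c b _ (hone j) t
  -- the phase `e^{−2πiμt}` is continuous of norm one
  have hcont_e : Continuous (fun t : ℝ => Complex.exp (-(2 * Real.pi * I * μ * t))) :=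
    Complex.continuous_exp.comp ((continuous_const.mul Complex.continuous_ofReal).neg)
  have hnorm_e : ∀ t : ℝ, ‖Complex.exp (-(2 * Real.pi * I * μ * t))‖ ≤ 1 := fun t => by
    rw [show (-(2 * Real.pi * I * μ * t) : ℂ) = ((-(2 * Real.pi * μ * t) : ℝ) : ℂ) * I by push_cast; ring, Complex.norm_exp_ofReal_mul_I]
  -- integrability of each summand (the by-value `hint` at the line point `n₁(b₀) · m₁(a,d)`, through the corner reading)
  have hI : ∀ j ∈ (Finset.univ : Finset (Fin d)), Integrable (fun t : ℝ => τ i j *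
      F j (ι (Matrix.J (Fin 1) ℂ * fromBlocks 1 ((t : ℂ) • (1 : Matrix (Fin 1) (Fin 1) ℂ)) 0 1) *
        (fromBlocks !![r, 0; 0, 1] 0 0 !![(conj r)⁻¹, 0; 0, 1] * fromBlocks !![1, u; 0, 1] 0 0 !![1, 0; -conj u, 1] *
          fromBlocks 1 !![(b : ℂ), c; conj c, 0] 0 1 * ι (fromBlocks 1 ((b₀ : ℂ) • (1 : Matrix (Fin 1) (Fin 1) ℂ)) 0 1 * fromBlocks a 0 0 dm) * 1)) *
      Complex.exp (-(2 * Real.pi * I * μ * t))) := fun j _ => by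
    simp_rw [hread j]
    have h1 : Integrable (fun t : ℝ => τ i j * (1 * (χ r * ((‖r‖ : ℝ) : ℂ) ^ (2 * s + 2)) *
        F j (ι (Matrix.J (Fin 1) ℂ * fromBlocks 1 ((t : ℂ) • (1 : Matrix (Fin 1) (Fin 1) ℂ)) 0 1 *
          (fromBlocks 1 ((b₀ : ℂ) • (1 : Matrix (Fin 1) (Fin 1) ℂ)) 0 1 * fromBlocks a 0 0 dm))))) :=
      ((hint j _).const_mul _).const_mul _
    exact h1.mul_bdd hcont_e.aestronglyMeasurable (Filter.Eventually.of_forall hnorm_e)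
  -- the integral splits over the tuple
  have hsum : (∫ t : ℝ, F i (ι (Matrix.J (Fin 1) ℂ * fromBlocks 1 ((t : ℂ) • (1 : Matrix (Fin 1) (Fin 1) ℂ)) 0 1) * (fromBlocks Y B 0 D * κ)) *
        Complex.exp (-(2 * Real.pi * I * μ * t))) =
      ∑ j, τ i j * ∫ t : ℝ, F j (ι (Matrix.J (Fin 1) ℂ * fromBlocks 1 ((t : ℂ) • (1 : Matrix (Fin 1) (Fin 1) ℂ)) 0 1) *
        (fromBlocks !![r, 0; 0, 1] 0 0 !![(conj r)⁻¹, 0; 0, 1] * fromBlocks !![1, u; 0, 1] 0 0 !![1, 0; -conj u, 1] *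
          fromBlocks 1 !![(b : ℂ), c; conj c, 0] 0 1 * ι (fromBlocks 1 ((b₀ : ℂ) • (1 : Matrix (Fin 1) (Fin 1) ℂ)) 0 1 * fromBlocks a 0 0 dm) * 1)) *
      Complex.exp (-(2 * Real.pi * I * μ * t)) := by
    have hfun : (fun t : ℝ => F i (ι (Matrix.J (Fin 1) ℂ * fromBlocks 1 ((t : ℂ) • (1 : Matrix (Fin 1) (Fin 1) ℂ)) 0 1) * (fromBlocks Y B 0 D * κ)) *
        Complex.exp (-(2 * Real.pi * I * μ * t))) = fun t : ℝ => ∑ j, τ i j * F j (ι (Matrix.J (Fin 1) ℂ * fromBlocks 1 ((t : ℂ) • (1 : Matrix (Fin 1) (Fin 1) ℂ)) 0 1) *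
        (fromBlocks !![r, 0; 0, 1] 0 0 !![(conj r)⁻¹, 0; 0, 1] * fromBlocks !![1, u; 0, 1] 0 0 !![1, 0; -conj u, 1] *
          fromBlocks 1 !![(b : ℂ), c; conj c, 0] 0 1 * ι (fromBlocks 1 ((b₀ : ℂ) • (1 : Matrix (Fin 1) (Fin 1) ℂ)) 0 1 * fromBlocks a 0 0 dm) * 1)) *
      Complex.exp (-(2 * Real.pi * I * μ * t)) := by
      funext t
      rw [hsplit t, Finset.sum_mul]
    rw [hfun, integral_finsetSum _ hI]
    refine Finset.sum_congr rfl fun j _ => ?_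
    rw [← integral_const_mul]
    refine integral_congr_ae (Filter.Eventually.of_forall fun t => ?_)
    simp only [mul_assoc]
  -- each component integral, read at the Iwasawa point (★ (e∞), `κ := 1`)
  have hkey : ∀ j : Fin d, (∫ t : ℝ, F j (ι (Matrix.J (Fin 1) ℂ * fromBlocks 1 ((t : ℂ) • (1 : Matrix (Fin 1) (Fin 1) ℂ)) 0 1) *
        (fromBlocks !![r, 0; 0, 1] 0 0 !![(conj r)⁻¹, 0; 0, 1] * fromBlocks !![1, u; 0, 1] 0 0 !![1, 0; -conj u, 1] *
          fromBlocks 1 !![(b : ℂ), c; conj c, 0] 0 1 * ι (fromBlocks 1 ((b₀ : ℂ) • (1 : Matrix (Fin 1) (Fin 1) ℂ)) 0 1 * fromBlocks a 0 0 dm) * 1)) *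
      Complex.exp (-(2 * Real.pi * I * μ * t))) =
      1 * (χ r * ((‖r‖ : ℝ) : ℂ) ^ (2 * s + 2)) *
        (Complex.exp (2 * Real.pi * I * μ * b₀) * (χ (dm 0 0) * ((‖a 0 0‖ : ℝ) : ℂ) ^ (1 - 2 * (s + 1 / 2))) *
          ∫ t : ℝ, F j (ι (Matrix.J (Fin 1) ℂ * fromBlocks 1 ((t : ℂ) • (1 : Matrix (Fin 1) (Fin 1) ℂ)) 0 1)) *
            Complex.exp (-(2 * Real.pi * I * ((‖a 0 0‖ ^ 2 * μ : ℝ) : ℂ) * t))) := fun j =>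
    corner_lineWhittaker_iwasawa ι hι (hf j) hχ1 hr u c b had b₀ (hone j) μ
  have hna : ‖a 0 0‖ = n := by rw [ha00, Complex.norm_real, Real.norm_of_nonneg hn.le]
  have hrpos : 0 < ‖r‖ := norm_pos_iff.2 hr
  have hd0 : dm 0 0 ≠ 0 := by rw [hd00]; exact inv_ne_zero hnC
  have habs : |n ^ 2 * μ| = |μ| * n ^ 2 := by rw [abs_mul, abs_of_nonneg (sq_nonneg n), mul_comm]
  have e1 : ‖((‖r‖ : ℝ) : ℂ) ^ (2 * s + 2)‖ = ‖r‖ ^ (2 * s.re + 2) := by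
    rw [Complex.norm_cpow_eq_rpow_re_of_pos hrpos]; simp
  have e2 : ‖((‖a 0 0‖ : ℝ) : ℂ) ^ (1 - 2 * (s + 1 / 2))‖ = n ^ (-(2 * s.re)) := by
    rw [hna, Complex.norm_cpow_eq_rpow_re_of_pos hn]
    congr 1
    simp; ring
  have hcomp : ∀ j : Fin d, ‖∫ t : ℝ, F j (ι (Matrix.J (Fin 1) ℂ * fromBlocks 1 ((t : ℂ) • (1 : Matrix (Fin 1) (Fin 1) ℂ)) 0 1) *
        (fromBlocks !![r, 0; 0, 1] 0 0 !![(conj r)⁻¹, 0; 0, 1] * fromBlocks !![1, u; 0, 1] 0 0 !![1, 0; -conj u, 1] *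
          fromBlocks 1 !![(b : ℂ), c; conj c, 0] 0 1 * ι (fromBlocks 1 ((b₀ : ℂ) • (1 : Matrix (Fin 1) (Fin 1) ℂ)) 0 1 * fromBlocks a 0 0 dm) * 1)) *
      Complex.exp (-(2 * Real.pi * I * μ * t))‖ ≤
      ‖r‖ ^ (2 * s.re + 2) * n ^ (-(2 * s.re)) * (CL * (1 + |μ| * n ^ 2) * Real.exp (-(Real.pi * (|μ| * n ^ 2)))) := fun j => by
    have hL := hline j (‖a 0 0‖ ^ 2 * μ)
    rw [hna, habs] at hL
    rw [hkey j]
    calc ‖1 * (χ r * ((‖r‖ : ℝ) : ℂ) ^ (2 * s + 2)) *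
          (Complex.exp (2 * Real.pi * I * μ * b₀) * (χ (dm 0 0) * ((‖a 0 0‖ : ℝ) : ℂ) ^ (1 - 2 * (s + 1 / 2))) *
            ∫ t : ℝ, F j (ι (Matrix.J (Fin 1) ℂ * fromBlocks 1 ((t : ℂ) • (1 : Matrix (Fin 1) (Fin 1) ℂ)) 0 1)) *
              Complex.exp (-(2 * Real.pi * I * ((‖a 0 0‖ ^ 2 * μ : ℝ) : ℂ) * t)))‖
        = ‖χ r‖ * ‖r‖ ^ (2 * s.re + 2) * ‖χ (dm 0 0)‖ * n ^ (-(2 * s.re)) *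
            ‖∫ t : ℝ, F j (ι (Matrix.J (Fin 1) ℂ * fromBlocks 1 ((t : ℂ) • (1 : Matrix (Fin 1) (Fin 1) ℂ)) 0 1)) *
                Complex.exp (-(2 * Real.pi * I * ((n ^ 2 * μ : ℝ) : ℂ) * t))‖ := by
          rw [norm_mul, norm_mul, norm_mul, norm_mul, norm_mul, norm_mul, norm_one, one_mul, norm_exp_phase, one_mul, e1, e2, hna]
          ring
      _ ≤ 1 * ‖r‖ ^ (2 * s.re + 2) * 1 * n ^ (-(2 * s.re)) * (CL * (1 + |μ| * n ^ 2) * Real.exp (-(Real.pi * (|μ| * n ^ 2)))) := by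
          gcongr
          · exact hχ r hr
          · exact hχ _ hd0
      _ = _ := by ring
  rw [hsum]
  calc ‖∑ j, τ i j * ∫ t : ℝ, F j (ι (Matrix.J (Fin 1) ℂ * fromBlocks 1 ((t : ℂ) • (1 : Matrix (Fin 1) (Fin 1) ℂ)) 0 1) *
        (fromBlocks !![r, 0; 0, 1] 0 0 !![(conj r)⁻¹, 0; 0, 1] * fromBlocks !![1, u; 0, 1] 0 0 !![1, 0; -conj u, 1] *
          fromBlocks 1 !![(b : ℂ), c; conj c, 0] 0 1 * ι (fromBlocks 1 ((b₀ : ℂ) • (1 : Matrix (Fin 1) (Fin 1) ℂ)) 0 1 * fromBlocks a 0 0 dm) * 1)) *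
      Complex.exp (-(2 * Real.pi * I * μ * t))‖
      ≤ ∑ j, ‖τ i j * ∫ t : ℝ, F j (ι (Matrix.J (Fin 1) ℂ * fromBlocks 1 ((t : ℂ) • (1 : Matrix (Fin 1) (Fin 1) ℂ)) 0 1) *
        (fromBlocks !![r, 0; 0, 1] 0 0 !![(conj r)⁻¹, 0; 0, 1] * fromBlocks !![1, u; 0, 1] 0 0 !![1, 0; -conj u, 1] *
          fromBlocks 1 !![(b : ℂ), c; conj c, 0] 0 1 * ι (fromBlocks 1 ((b₀ : ℂ) • (1 : Matrix (Fin 1) (Fin 1) ℂ)) 0 1 * fromBlocks a 0 0 dm) * 1)) *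
      Complex.exp (-(2 * Real.pi * I * μ * t))‖ := norm_sum_le _ _
    _ ≤ ∑ _j : Fin d, 1 * (‖r‖ ^ (2 * s.re + 2) * n ^ (-(2 * s.re)) * (CL * (1 + |μ| * n ^ 2) * Real.exp (-(Real.pi * (|μ| * n ^ 2))))) :=
        Finset.sum_le_sum fun j _ => by
          rw [norm_mul]
          exact mul_le_mul (hτ i j) (hcomp j) (norm_nonneg _) zero_le_one
    _ = d * (‖r‖ ^ (2 * s.re + 2) * n ^ (-(2 * s.re)) * (CL * (1 + |μ| * n ^ 2) * Real.exp (-(Real.pi * (|μ| * n ^ 2))))) := by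
        rw [Finset.sum_const, Finset.card_univ, Fintype.card_fin, nsmul_eq_mul, one_mul]
    _ = d * CL * ((n ^ 2) ^ (-(2 * s.re + 1)) * (‖r‖ * n) ^ (2 * s.re + 2)) * ((1 + |μ| * n ^ 2) * Real.exp (-(Real.pi * (|μ| * n ^ 2)))) := by
        rw [← rpow_bookkeeping (norm_nonneg r) hn]; ring
    _ = _ := by rw [hn2, hrn]; ring

/-! ## §2 The mover comparison with an abstract left side, and the `M`-bounded twin -/

/-- **THE MOVER COMPARISON OF ★ (β-3), LEFT SIDE ABSTRACTED.**  If a real `Q` is bounded by the (β-2)-shape `C_L·ρ₀^{−(2re s+1)}·‖det Y₀‖^{2re s+2}·((1+|μ|ρ₀)e^{−π|μ|ρ₀})` at EVERY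
unitary-mover decomposition `g = [Y₀,B₀;0,D₀]·k₀` of `g = [Y,B;0,D]·κ ∈ U(J)` (`κκ′ = 1`, entries `≤ M`, `M ≥ 1`), then `Q ≤ C_L·(64M²)^{|2re s+1|+1}·(32M²)^{|2re s+2|}·
ρ^{−(2re s+1)}·‖det Y‖^{2re s+2}·((1+|μ|ρ)·e^{−(π∕64M²)|μ|ρ})` — ★ (β-3)'s proof verbatim with the left side abstracted (any head of (β-2) shape transfers to the `M`-bounded class).
[cite: BorelJacquet1979, §1.2, §4.1] [cite: MoeglinWaldspurger1995, I.2.2, II.1.7] -/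
theorem le_of_unitary_decompositions {Q CL : ℝ} (hCL : 0 ≤ CL) (s : ℂ) (μ : ℝ) {M : ℝ} (hM : 1 ≤ M)
    {Y B D : Matrix (Fin 2) (Fin 2) ℂ} {κ κ' : Matrix (Fin 2 ⊕ Fin 2) (Fin 2 ⊕ Fin 2) ℂ}
    (hg : (fromBlocks Y B 0 D * κ)ᴴ * Matrix.J (Fin 2) ℂ * (fromBlocks Y B 0 D * κ) = Matrix.J (Fin 2) ℂ) (hκκ' : κ * κ' = 1)
    (hκe : ∀ i j, ‖κ i j‖ ≤ M) (hκe' : ∀ i j, ‖κ' i j‖ ≤ M)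
    (hB : ∀ (Y₀ B₀ D₀ : Matrix (Fin 2) (Fin 2) ℂ) (k₀ : Matrix (Fin 2 ⊕ Fin 2) (Fin 2 ⊕ Fin 2) ℂ),
      fromBlocks Y B 0 D * κ = fromBlocks Y₀ B₀ 0 D₀ * k₀ → k₀ * k₀ᴴ = 1 → k₀ᴴ * k₀ = 1 →
      Q ≤ CL * (∑ j, ‖Y₀ 1 j‖ ^ 2) ^ (-(2 * s.re + 1)) * ‖Y₀.det‖ ^ (2 * s.re + 2) *
        ((1 + |μ| * ∑ j, ‖Y₀ 1 j‖ ^ 2) * Real.exp (-(Real.pi * (|μ| * ∑ j, ‖Y₀ 1 j‖ ^ 2))))) :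
    Q ≤ CL * (64 * M ^ 2) ^ (|2 * s.re + 1| + 1) * (32 * M ^ 2) ^ |2 * s.re + 2| *
        ((∑ j, ‖Y 1 j‖ ^ 2) ^ (-(2 * s.re + 1)) * ‖Y.det‖ ^ (2 * s.re + 2) *
          ((1 + |μ| * ∑ j, ‖Y 1 j‖ ^ 2) * Real.exp (-(Real.pi / (64 * M ^ 2) * (|μ| * ∑ j, ‖Y 1 j‖ ^ 2))))) := by
  have hM0 : 0 ≤ M := zero_le_one.trans hM
  have hκ'κ : κ' * κ = 1 := mul_eq_one_comm.1 hκκ'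
  -- `g` is invertible (`(−J gᴴ J) g = 1`)
  have hJJ : Matrix.J (Fin 2) ℂ * Matrix.J (Fin 2) ℂ = -1 := Matrix.J_squared _ _
  have hginv : (-(Matrix.J (Fin 2) ℂ * (fromBlocks Y B 0 D * κ)ᴴ * Matrix.J (Fin 2) ℂ)) * (fromBlocks Y B 0 D * κ) = 1 := by
    rw [Matrix.neg_mul, Matrix.mul_assoc, Matrix.mul_assoc, ← Matrix.mul_assoc ((fromBlocks Y B 0 D * κ)ᴴ), hg, hJJ, neg_neg]
  have hdetg : (fromBlocks Y B 0 D * κ).det ≠ 0 := by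
    have h := congrArg Matrix.det hginv
    rw [det_mul, det_one] at h
    exact right_ne_zero_of_mul_eq_one h
  have hunit : IsUnit (fromBlocks Y B 0 D * κ) := (Matrix.isUnit_iff_isUnit_det _).2 (isUnit_iff_ne_zero.2 hdetg)
  -- the unitary-mover (QR) decomposition and §1 there
  obtain ⟨P, k₀, hk₀, hP21, hgP⟩ := exists_blockUpper_mul_unitary _ hunit
  have hk₀' : k₀ * k₀ᴴ = 1 := by simpa [Matrix.star_eq_conjTranspose] using Matrix.mem_unitaryGroup_iff.1 hk₀
  have hk₀'' : k₀ᴴ * k₀ = 1 := by simpa [Matrix.star_eq_conjTranspose] using Matrix.mem_unitaryGroup_iff'.1 hk₀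
  have hP : P = fromBlocks P.toBlocks₁₁ P.toBlocks₁₂ 0 P.toBlocks₂₂ := by
    conv_lhs => rw [← fromBlocks_toBlocks P, hP21]
  set Y₀ := P.toBlocks₁₁ with hY₀
  set B₀ := P.toBlocks₁₂ with hB₀
  set D₀ := P.toBlocks₂₂ with hD₀
  have hg₀ : fromBlocks Y B 0 D * κ = fromBlocks Y₀ B₀ 0 D₀ * k₀ := by rw [← hP]; exact hgP
  have hB := hB Y₀ B₀ D₀ k₀ hg₀ hk₀' hk₀''
  have hPV : fromBlocks Y B 0 D = fromBlocks Y₀ B₀ 0 D₀ * (k₀ * κ') := by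
    calc fromBlocks Y B 0 D = fromBlocks Y B 0 D * (κ * κ') := by rw [hκκ', Matrix.mul_one]
      _ = (fromBlocks Y B 0 D * κ) * κ' := by rw [Matrix.mul_assoc]
      _ = fromBlocks Y₀ B₀ 0 D₀ * (k₀ * κ') := by rw [hg₀, Matrix.mul_assoc]
  have hPW : fromBlocks Y₀ B₀ 0 D₀ = fromBlocks Y B 0 D * (κ * k₀ᴴ) := by
    calc fromBlocks Y₀ B₀ 0 D₀ = fromBlocks Y₀ B₀ 0 D₀ * (k₀ * k₀ᴴ) := by rw [hk₀', Matrix.mul_one]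
      _ = (fromBlocks Y₀ B₀ 0 D₀ * k₀) * k₀ᴴ := by rw [Matrix.mul_assoc]
      _ = fromBlocks Y B 0 D * (κ * k₀ᴴ) := by rw [← hg₀, Matrix.mul_assoc]
  have hdetk₀ : k₀.det ≠ 0 := by
    intro h0
    have h := congrArg Matrix.det hk₀'
    rw [det_mul, h0, zero_mul, det_one] at h
    exact zero_ne_one h
  have hdetD₀ : D₀.det ≠ 0 := by
    intro h0
    apply hdetg
    rw [hg₀, det_mul, Matrix.det_fromBlocks_zero₂₁, h0, mul_zero, zero_mul]
  have hdetκ : κ.det ≠ 0 := by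
    intro h0
    have h := congrArg Matrix.det hκκ'
    rw [det_mul, h0, zero_mul, det_one] at h
    exact zero_ne_one h
  have hdetD : D.det ≠ 0 := by
    intro h0
    apply hdetg
    rw [det_mul, Matrix.det_fromBlocks_zero₂₁, h0, mul_zero, zero_mul]
  -- `Y = Y₀ V₁₁`, `Y₀ = Y W₁₁`
  have hVblocks := hPV
  rw [← fromBlocks_toBlocks (k₀ * κ'), fromBlocks_multiply] at hVblocks
  simp only [Matrix.zero_mul, zero_add, fromBlocks_inj] at hVblocks
  obtain ⟨hY, -, hV21, -⟩ := hVblocks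
  have hV21' : (k₀ * κ').toBlocks₂₁ = 0 := by
    have h := congrArg (fun X => D₀⁻¹ * X) hV21
    simpa only [← Matrix.mul_assoc, Matrix.nonsing_inv_mul _ (isUnit_iff_ne_zero.2 hdetD₀), Matrix.one_mul, Matrix.mul_zero] using h.symm
  rw [hV21', Matrix.mul_zero, add_zero] at hY
  have hWblocks := hPW
  rw [← fromBlocks_toBlocks (κ * k₀ᴴ), fromBlocks_multiply] at hWblocks
  simp only [Matrix.zero_mul, zero_add, fromBlocks_inj] at hWblocks
  obtain ⟨hY₀, -, hW21, -⟩ := hWblocks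
  have hW21' : (κ * k₀ᴴ).toBlocks₂₁ = 0 := by
    have h := congrArg (fun X => D⁻¹ * X) hW21
    simpa only [← Matrix.mul_assoc, Matrix.nonsing_inv_mul _ (isUnit_iff_ne_zero.2 hdetD), Matrix.one_mul, Matrix.mul_zero] using h.symm
  rw [hW21', Matrix.mul_zero, add_zero] at hY₀
  -- entry bounds `≤ 4M` for `V₁₁`, `W₁₁`
  have hVe : ∀ i j, ‖(k₀ * κ').toBlocks₁₁ i j‖ ≤ 4 * M := fun i j => norm_unitary_mul_apply_le hk₀ hκe' _ _
  have hWe : ∀ i j, ‖(κ * k₀ᴴ).toBlocks₁₁ i j‖ ≤ 4 * M := fun i j => norm_mul_unitary_conjTranspose_apply_le hk₀ hM0 hκe _ _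
  -- the two corner rows and the two determinants, two-sided within `64M²`, `32M²`
  have hρle : ∑ j, ‖Y 1 j‖ ^ 2 ≤ 64 * M ^ 2 * ∑ j, ‖Y₀ 1 j‖ ^ 2 := by
    have h := rowSq_mul_le Y₀ _ hVe 1
    rw [← hY] at h
    linarith
  have hρ₀le : ∑ j, ‖Y₀ 1 j‖ ^ 2 ≤ 64 * M ^ 2 * ∑ j, ‖Y 1 j‖ ^ 2 := by
    have h := rowSq_mul_le Y _ hWe 1
    rw [← hY₀] at h
    linarith
  have hdetVle : ‖((k₀ * κ').toBlocks₁₁).det‖ ≤ 32 * M ^ 2 := by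
    have h := norm_det_le_of_entry_le hVe
    simp only [Fintype.card_fin, Nat.factorial_two, Nat.cast_ofNat] at h
    linarith
  have hdetWle : ‖((κ * k₀ᴴ).toBlocks₁₁).det‖ ≤ 32 * M ^ 2 := by
    have h := norm_det_le_of_entry_le hWe
    simp only [Fintype.card_fin, Nat.factorial_two, Nat.cast_ofNat] at h
    linarith
  have hδle : ‖Y.det‖ ≤ 32 * M ^ 2 * ‖Y₀.det‖ := by
    rw [hY, det_mul, norm_mul, mul_comm]
    exact mul_le_mul_of_nonneg_right hdetVle (norm_nonneg _)
  have hδ₀le : ‖Y₀.det‖ ≤ 32 * M ^ 2 * ‖Y.det‖ := by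
    rw [hY₀, det_mul, norm_mul, mul_comm ‖Y.det‖]
    exact mul_le_mul_of_nonneg_right hdetWle (norm_nonneg _)
  have hdetY : Y.det ≠ 0 := by
    intro h0; apply hdetg; rw [det_mul, Matrix.det_fromBlocks_zero₂₁, h0, zero_mul, zero_mul]
  have hdetY₀ : Y₀.det ≠ 0 := by
    intro h0; apply hdetg; rw [hg₀, det_mul, Matrix.det_fromBlocks_zero₂₁, h0, zero_mul, zero_mul]
  have hδ : 0 < ‖Y.det‖ := norm_pos_iff.2 hdetY
  have hδ₀ : 0 < ‖Y₀.det‖ := norm_pos_iff.2 hdetY₀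
  have hrow_pos : ∀ {Z : Matrix (Fin 2) (Fin 2) ℂ}, Z.det ≠ 0 → 0 < ∑ j, ‖Z 1 j‖ ^ 2 := fun {Z} hZ => by
    by_contra hle
    have h0 : ∑ j, ‖Z 1 j‖ ^ 2 = 0 := le_antisymm (not_lt.1 hle) (Finset.sum_nonneg fun j _ => sq_nonneg _)
    rw [Finset.sum_eq_zero_iff_of_nonneg fun j _ => sq_nonneg _] at h0
    have hz : ∀ j, Z 1 j = 0 := fun j => norm_eq_zero.1 (pow_eq_zero_iff two_ne_zero |>.1 (h0 j (Finset.mem_univ j)))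
    apply hZ
    rw [Matrix.det_fin_two, hz 0, hz 1, mul_zero, mul_zero, sub_zero]
  have hρ : 0 < ∑ j, ‖Y 1 j‖ ^ 2 := hrow_pos hdetY
  have hρ₀ : 0 < ∑ j, ‖Y₀ 1 j‖ ^ 2 := hrow_pos hdetY₀
  -- conversion of the four factors
  have h64 : (1 : ℝ) ≤ 64 * M ^ 2 := by nlinarith
  have hf1 : (∑ j, ‖Y₀ 1 j‖ ^ 2) ^ (-(2 * s.re + 1)) ≤ (64 * M ^ 2) ^ |2 * s.re + 1| * (∑ j, ‖Y 1 j‖ ^ 2) ^ (-(2 * s.re + 1)) := by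
    have h := rpow_le_mul_rpow_of_two_sided hρ₀ hρ hρ₀le hρle (-(2 * s.re + 1))
    rwa [abs_neg] at h
  have hf2 : ‖Y₀.det‖ ^ (2 * s.re + 2) ≤ (32 * M ^ 2) ^ |2 * s.re + 2| * ‖Y.det‖ ^ (2 * s.re + 2) :=
    rpow_le_mul_rpow_of_two_sided hδ₀ hδ hδ₀le hδle _
  have hf3 : 1 + |μ| * ∑ j, ‖Y₀ 1 j‖ ^ 2 ≤ 64 * M ^ 2 * (1 + |μ| * ∑ j, ‖Y 1 j‖ ^ 2) := by
    have hμ : 0 ≤ |μ| := abs_nonneg μ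
    nlinarith [mul_le_mul_of_nonneg_left hρ₀le hμ, hρ.le]
  have hf4 : Real.exp (-(Real.pi * (|μ| * ∑ j, ‖Y₀ 1 j‖ ^ 2))) ≤ Real.exp (-(Real.pi / (64 * M ^ 2) * (|μ| * ∑ j, ‖Y 1 j‖ ^ 2))) := by
    rw [Real.exp_le_exp, neg_le_neg_iff]
    have hμ : 0 ≤ |μ| := abs_nonneg μ
    have h1 : Real.pi / (64 * M ^ 2) * (|μ| * ∑ j, ‖Y 1 j‖ ^ 2) ≤ Real.pi / (64 * M ^ 2) * (|μ| * (64 * M ^ 2 * ∑ j, ‖Y₀ 1 j‖ ^ 2)) :=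
      mul_le_mul_of_nonneg_left (mul_le_mul_of_nonneg_left hρle hμ) (by positivity)
    have h2 : Real.pi / (64 * M ^ 2) * (|μ| * (64 * M ^ 2 * ∑ j, ‖Y₀ 1 j‖ ^ 2)) = Real.pi * (|μ| * ∑ j, ‖Y₀ 1 j‖ ^ 2) := by
      field_simp
    linarith
  -- assemble
  have hA0 : 0 ≤ (64 * M ^ 2) ^ |2 * s.re + 1| * (∑ j, ‖Y 1 j‖ ^ 2) ^ (-(2 * s.re + 1)) := by positivity
  have hB0 : 0 ≤ (32 * M ^ 2) ^ |2 * s.re + 2| * ‖Y.det‖ ^ (2 * s.re + 2) := by positivity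
  have hE0 : 0 ≤ Real.exp (-(Real.pi * (|μ| * ∑ j, ‖Y₀ 1 j‖ ^ 2))) := (Real.exp_pos _).le
  have hC0 : 0 ≤ 1 + |μ| * ∑ j, ‖Y₀ 1 j‖ ^ 2 := by positivity
  calc _ ≤ CL * (∑ j, ‖Y₀ 1 j‖ ^ 2) ^ (-(2 * s.re + 1)) * ‖Y₀.det‖ ^ (2 * s.re + 2) *
        ((1 + |μ| * ∑ j, ‖Y₀ 1 j‖ ^ 2) * Real.exp (-(Real.pi * (|μ| * ∑ j, ‖Y₀ 1 j‖ ^ 2)))) := hB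
    _ ≤ CL * ((64 * M ^ 2) ^ |2 * s.re + 1| * (∑ j, ‖Y 1 j‖ ^ 2) ^ (-(2 * s.re + 1))) * ((32 * M ^ 2) ^ |2 * s.re + 2| * ‖Y.det‖ ^ (2 * s.re + 2)) *
        ((64 * M ^ 2 * (1 + |μ| * ∑ j, ‖Y 1 j‖ ^ 2)) * Real.exp (-(Real.pi / (64 * M ^ 2) * (|μ| * ∑ j, ‖Y 1 j‖ ^ 2)))) := by
        gcongr
    _ = CL * ((64 * M ^ 2) ^ |2 * s.re + 1| * (64 * M ^ 2)) * (32 * M ^ 2) ^ |2 * s.re + 2| *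
        ((∑ j, ‖Y 1 j‖ ^ 2) ^ (-(2 * s.re + 1)) * ‖Y.det‖ ^ (2 * s.re + 2) *
          ((1 + |μ| * ∑ j, ‖Y 1 j‖ ^ 2) * Real.exp (-(Real.pi / (64 * M ^ 2) * (|μ| * ∑ j, ‖Y 1 j‖ ^ 2))))) := by ring
    _ = _ := by rw [Real.rpow_add_one (by positivity : (64 * M ^ 2 : ℝ) ≠ 0)]


include hι in
/-- **THE `M`-BOUNDED TWIN FOR A FINITE-DIMENSIONAL `K_w`-TYPE** (payer-chosen rate `π∕(64M²)`): §1 at every unitary-mover decomposition, transferred by §2.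
[cite: Shimura1997, §16, §18.4] [cite: BorelJacquet1979, §1.2, §4.1] [cite: MoeglinWaldspurger1995, II.1.7] -/
theorem norm_corner_lineWhittaker_le_of_boundedMovers_kType {d : ℕ}
    {χ : ℂ → ℂ} {s : ℂ} {F : Fin d → Matrix (Fin 2 ⊕ Fin 2) (Fin 2 ⊕ Fin 2) ℂ → ℂ} (hf : ∀ j, IsArchSiegelSection χ s (F j)) (hχ1 : χ 1 = 1)
    (hχ : ∀ z : ℂ, z ≠ 0 → ‖χ z‖ ≤ 1)
    (hK : ∀ k : Matrix (Fin 2 ⊕ Fin 2) (Fin 2 ⊕ Fin 2) ℂ, kᴴ * Matrix.J (Fin 2) ℂ * k = Matrix.J (Fin 2) ℂ →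
      moeb k (I • (1 : Matrix (Fin 2) (Fin 2) ℂ)) = I • 1 →
      ∃ τ : Matrix (Fin d) (Fin d) ℂ, (∀ i j, ‖τ i j‖ ≤ 1) ∧ ∀ (g : Matrix (Fin 2 ⊕ Fin 2) (Fin 2 ⊕ Fin 2) ℂ) (i : Fin d), F i (g * k) = ∑ j, τ i j * F j g)
    {CL : ℝ} (hCL : 0 ≤ CL)
    (hline : ∀ (j : Fin d) (h : ℝ), ‖∫ t : ℝ, F j (ι (Matrix.J (Fin 1) ℂ * fromBlocks 1 ((t : ℂ) • (1 : Matrix (Fin 1) (Fin 1) ℂ)) 0 1)) *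
        Complex.exp (-(2 * Real.pi * I * h * t))‖ ≤ CL * (1 + |h|) * Real.exp (-(Real.pi * |h|)))
    (hint : ∀ (j : Fin d) (x : Matrix (Fin 1 ⊕ Fin 1) (Fin 1 ⊕ Fin 1) ℂ),
      Integrable (fun t : ℝ => F j (ι (Matrix.J (Fin 1) ℂ * fromBlocks 1 ((t : ℂ) • (1 : Matrix (Fin 1) (Fin 1) ℂ)) 0 1 * x))))
    {M : ℝ} (hM : 1 ≤ M)
    {Y B D : Matrix (Fin 2) (Fin 2) ℂ} {κ κ' : Matrix (Fin 2 ⊕ Fin 2) (Fin 2 ⊕ Fin 2) ℂ}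
    (hg : (fromBlocks Y B 0 D * κ)ᴴ * Matrix.J (Fin 2) ℂ * (fromBlocks Y B 0 D * κ) = Matrix.J (Fin 2) ℂ) (hκκ' : κ * κ' = 1)
    (hκe : ∀ i j, ‖κ i j‖ ≤ M) (hκe' : ∀ i j, ‖κ' i j‖ ≤ M) (μ : ℝ) (i : Fin d) :
    ‖∫ t : ℝ, F i (ι (Matrix.J (Fin 1) ℂ * fromBlocks 1 ((t : ℂ) • (1 : Matrix (Fin 1) (Fin 1) ℂ)) 0 1) * (fromBlocks Y B 0 D * κ)) *
        Complex.exp (-(2 * Real.pi * I * μ * t))‖ ≤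
      (d * CL) * (64 * M ^ 2) ^ (|2 * s.re + 1| + 1) * (32 * M ^ 2) ^ |2 * s.re + 2| *
        ((∑ j, ‖Y 1 j‖ ^ 2) ^ (-(2 * s.re + 1)) * ‖Y.det‖ ^ (2 * s.re + 2) *
          ((1 + |μ| * ∑ j, ‖Y 1 j‖ ^ 2) * Real.exp (-(Real.pi / (64 * M ^ 2) * (|μ| * ∑ j, ‖Y 1 j‖ ^ 2))))) := by
  refine le_of_unitary_decompositions (by positivity) s μ hM hg hκκ' hκe hκe' fun Y₀ B₀ D₀ k₀ hg₀ hk₀ hk₀' => ?_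
  have hg₀J : (fromBlocks Y₀ B₀ 0 D₀ * k₀)ᴴ * Matrix.J (Fin 2) ℂ * (fromBlocks Y₀ B₀ 0 D₀ * k₀) = Matrix.J (Fin 2) ℂ := by rw [← hg₀]; exact hg
  have h := norm_corner_lineWhittaker_le_of_blockDecomp_kType ι hι hf hχ1 hχ hK hline hint hg₀J hk₀ hk₀' μ i
  rw [← hg₀] at h
  exact h

end Summit.HodgeConjecture.HodgeConjecture.Cruxes.HLiu418.K2LiuKindOneLineCornerArchFactorKType

end
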